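import Literature.NumberTheory.DiophantineGeometry.AbcShapeGeometrySets
import Literature.NumberTheory.DiophantineGeometry.AbcShapeSubBox

-- Summit.ABC.ABC is the mandated summit-side namespace (single-conjunct summit); the lakefile sets the same option tree-wide.
set_option linter.dupNamespace false

/-!
# Fibring the shape count over the host coordinates outside `Q` (crux stmt-ABC-2757, stub `de_shapeCount_le_fibre`)

Stub W5 of the DE tool for the line `critical-kloosterman-powerful-moduli` of the crux
`Summit.ABC.ABC.Theses.TwistAmplification.MazurKaneLaw`.  The shape count
`B_d = AbcShapes.shapeCount c₁ c₂ c₃ X Y Z` counts the `(x, y, z)` in the dyadic boxes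
`[X, 2X) × [Y, 2Y) × [Z, 2Z)` with `c₁ ∏ xⱼ^{j+1} + c₂ ∏ yⱼ^{j+1} = c₃ ∏ zⱼ^{j+1}` and
`gcd(c₁ ∏ xⱼ, c₂ ∏ yⱼ, c₃ ∏ zⱼ) = 1`.  The DE tool reads its modulus `q(x) = W_Q(x) = ∏_{i∈Q} xᵢ^{i+1}`
(`AbcShapes.onVal Q x`) off the `x`-term; this file
(`Summit.ABC.ABC.Theorems.MazurKaneLaw.de_shapeCount_le_fibre`) forgets the `x`-coordinates outside
`Q` at a cost `Dτ^d`: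

* map a solution `(x, y, z) ↦ (freezeOn Qᶜ X x, y, z)`; the image lies in
  `subBox Qᶜ X × box Y × box Z` and satisfies: `W_Q(x)` is coprime to `c₂ V(y)` and to `c₃ V(z)`
  (it divides `c₁ V(x)`, which is coprime to both by `AbcShapes.coprime_terms_of_mem` and the
  equation) and `W_Q(x) ∣ c₃ V(z) - c₂ V(y) = c₁ V(x)`;
* two solutions with the same image share `(y, z)`, hence the value `m = V(x) ≤ T` (`c₁ ≥ 1`), and on
  such a fibre `x ↦ freezeOn Q X x` is injective with values among the tuples of `subBox Q X` whose
  free coordinates divide `m`: at most `τ(m)^d ≤ Dτ^d` of them (`AbcShapes.card_subBox_filter_dvd_le`);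
* hence `B_d ≤ Dτ^d · #image ≤ Dτ^d · #(filtered target set)` (`Finset.card_le_mul_card_image`).

No new definitions.
-/

namespace Summit.ABC.ABC.Theorems.MazurKaneLaw

open Finset
open Literature.NumberTheory.DiophantineGeometry
open Literature.NumberTheory.DiophantineGeometry.AbcShapes

/-- **Fibring the shape count over the host coordinates outside `Q`** (stub W5
`de_shapeCount_le_fibre` of the DE tool, line `critical-kloosterman-powerful-moduli`): for positive
`cᵢ`, boxes with positive parameters, `T ≥ c₁ ∏ⱼ (2Xⱼ)^{j+1}`, `τ(m) ≤ Dτ` for `1 ≤ m ≤ T` and a set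
`Q` of coordinates,
`B_d ≤ Dτ^d · #{(r, y, z) ∈ subBox Qᶜ X × box Y × box Z : gcd(W_Q(r), c₂V(y)) = gcd(W_Q(r), c₃V(z)) = 1,`
`W_Q(r) ∣ c₃V(z) - c₂V(y)}`.
Proof: send a solution `(x, y, z)` to `(freezeOn Qᶜ X x, y, z)` (the image satisfies the three
conditions since `W_Q(x) ∣ c₁V(x) = c₃V(z) - c₂V(y)` and the terms are pairwise coprime); on a fibre
`(y, z)` is fixed, so `V(x) = m` is fixed (`c₁ ≥ 1`), `m ≠ 0`, `m ≤ T`, and `x ↦ freezeOn Q X x` is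
injective into the tuples of `subBox Q X` whose free coordinates divide `m`, at most `τ(m)^d ≤ Dτ^d`
of them (`AbcShapes.card_subBox_filter_dvd_le`); conclude with `Finset.card_le_mul_card_image`.
[folklore] -/
theorem de_shapeCount_le_fibre : ∀ {d : ℕ} {c₁ c₂ c₃ : ℕ}, 0 < c₁ → 0 < c₂ → 0 < c₃ → ∀ (X Y Z : Fin d → ℕ), (∀ j, 0 < X j) → (∀ j, 0 < Y j) → (∀ j, 0 < Z j) → ∀ {T Dτ : ℕ}, c₁ * shapeVal (fun j => 2 * X j) ≤ T → (∀ m : ℕ, m ≠ 0 → m ≤ T → m.divisors.card ≤ Dτ) → ∀ (Q : Finset (Fin d)), (shapeCount c₁ c₂ c₃ X Y Z : ℝ) ≤ (Dτ : ℝ) ^ d * (((subBox Qᶜ X ×ˢ (dyadicBox Y ×ˢ dyadicBox Z)).filter (fun t : (Fin d → ℕ) × (Fin d → ℕ) × (Fin d → ℕ) => Nat.Coprime (onVal Q t.1) (c₂ * shapeVal t.2.1) ∧ Nat.Coprime (onVal Q t.1) (c₃ * shapeVal t.2.2) ∧ ((onVal Q t.1 : ℕ) : ℤ) ∣ ((c₃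 * shapeVal t.2.2 : ℕ) : ℤ) - ((c₂ * shapeVal t.2.1 : ℕ) : ℤ))).card : ℝ) := by
  intro d c₁ c₂ c₃ hc₁ _hc₂ _hc₃ X Y Z hX _hY _hZ T Dτ hTX hD Q
  set F := shapeTriples c₁ c₂ c₃ X Y Z
  set ψ : (Fin d → ℕ) × (Fin d → ℕ) × (Fin d → ℕ) → (Fin d → ℕ) × (Fin d → ℕ) × (Fin d → ℕ) :=
    fun t => (freezeOn Qᶜ X t.1, t.2.1, t.2.2) with hψ
  -- what membership in `F` means
  have hmem : ∀ t ∈ F, (t.1 ∈ dyadicBox X ∧ t.2.1 ∈ dyadicBox Y ∧ t.2.2 ∈ dyadicBox Z) ∧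
      c₁ * shapeVal t.1 + c₂ * shapeVal t.2.1 = c₃ * shapeVal t.2.2 ∧
      Nat.Coprime (c₁ * shapeVal t.1) (c₂ * shapeVal t.2.1) := by
    intro t ht
    have hcop := coprime_terms_of_mem ht
    obtain ⟨hbox, heq, -⟩ := mem_filter.mp ht
    exact ⟨by simpa only [mem_product] using hbox, heq, hcop⟩
  -- (a) each fibre of `ψ` has at most `Dτ^d` elements
  have hfib : F.card ≤ Dτ ^ d * (F.image ψ).card := by
    refine card_le_mul_card_image F (Dτ ^ d) fun w hw => ?_
    obtain ⟨t₁, ht₁, rfl⟩ := mem_image.mp hw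
    obtain ⟨⟨hbx₁, -, -⟩, heq₁, -⟩ := hmem t₁ ht₁
    have hx₁ := mem_dyadicBox.mp hbx₁
    set m : ℕ := shapeVal t₁.1 with hm
    have hm0 : m ≠ 0 := (shapeVal_pos fun j => lt_of_lt_of_le (hX j) (hx₁ j).1).ne'
    have hmT : m ≤ T :=
      (shapeVal_mono fun j => (hx₁ j).2.le).trans ((Nat.le_mul_of_pos_left _ hc₁).trans hTX)
    -- the tuples of `subBox Q X` whose free coordinates divide `m`
    have hcount : ((subBox Q X).filter (fun s => offVal Q s ∣ m)).card ≤ Dτ ^ d :=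
      (card_subBox_filter_dvd_le Q X hm0 (fun s => offVal Q s ∣ m)
        fun s _ hs i hi => (dvd_offVal Q s hi).trans hs).trans (Nat.pow_le_pow_left (hD m hm0 hmT) d)
    refine le_trans ?_ hcount
    -- on the fibre, `V(x) = m`, `(y, z) = (y₁, z₁)` and the `Q`-coordinates of `x` are those of `x₁`
    have hfm : ∀ t ∈ F.filter (fun t => ψ t = ψ t₁), t.1 ∈ dyadicBox X ∧
        freezeOn Qᶜ X t.1 = freezeOn Qᶜ X t₁.1 ∧ t.2 = t₁.2 ∧ shapeVal t.1 = m := by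
      intro t ht
      obtain ⟨htF, hψt⟩ := mem_filter.mp ht
      obtain ⟨⟨hbx, -, -⟩, heq, -⟩ := hmem t htF
      simp only [hψ, Prod.mk.injEq] at hψt
      obtain ⟨h1, h2, h3⟩ := hψt
      refine ⟨hbx, h1, Prod.ext h2 h3, Nat.eq_of_mul_eq_mul_left hc₁ ?_⟩
      apply Nat.add_right_cancel (m := c₂ * shapeVal t₁.2.1)
      rw [heq₁, ← h2, ← h3]
      exact heq
    refine card_le_card_of_injOn (fun t => freezeOn Q X t.1) (fun t ht => ?_)
      (fun t ht t' ht' h => ?_)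
    · obtain ⟨hbx, -, -, hval⟩ := hfm t (mem_coe.mp ht)
      refine mem_coe.mpr (mem_filter.mpr ⟨freezeOn_mem_subBox Q hbx, ?_⟩)
      rw [offVal_freezeOn, ← hval, shapeVal_eq_offVal_mul_onVal Q t.1]
      exact dvd_mul_right _ _
    · obtain ⟨-, f1, f2, -⟩ := hfm t (mem_coe.mp ht)
      obtain ⟨-, f1', f2', -⟩ := hfm t' (mem_coe.mp ht')
      dsimp only at h
      refine Prod.ext ?_ (f2.trans f2'.symm)
      rw [← mergeOn_freezeOn Q X t.1, ← mergeOn_freezeOn Q X t'.1, f1, f1', h]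
  -- (b) the image lies in the target set
  have himg : (F.image ψ).card ≤ ((subBox Qᶜ X ×ˢ (dyadicBox Y ×ˢ dyadicBox Z)).filter
      (fun t : (Fin d → ℕ) × (Fin d → ℕ) × (Fin d → ℕ) =>
        Nat.Coprime (onVal Q t.1) (c₂ * shapeVal t.2.1) ∧ Nat.Coprime (onVal Q t.1) (c₃ * shapeVal t.2.2) ∧
          ((onVal Q t.1 : ℕ) : ℤ) ∣ ((c₃ * shapeVal t.2.2 : ℕ) : ℤ) - ((c₂ * shapeVal t.2.1 : ℕ) : ℤ))).card := by
    refine card_le_card fun w hw => ?_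
    obtain ⟨t, htF, rfl⟩ := mem_image.mp hw
    obtain ⟨⟨hbx, hby, hbz⟩, heq, hcop⟩ := hmem t htF
    have hd1 : onVal Q t.1 ∣ c₁ * shapeVal t.1 := by
      rw [shapeVal_eq_offVal_mul_onVal Q t.1]; exact ⟨c₁ * offVal Q t.1, by ring⟩
    have h12 : Nat.Coprime (onVal Q t.1) (c₂ * shapeVal t.2.1) := hcop.coprime_dvd_left hd1
    have h13 : Nat.Coprime (onVal Q t.1) (c₃ * shapeVal t.2.2) := by
      rw [← heq]; exact (Nat.coprime_self_add_right.mpr hcop).coprime_dvd_left hd1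
    have hdvd : ((onVal Q t.1 : ℕ) : ℤ) ∣
        ((c₃ * shapeVal t.2.2 : ℕ) : ℤ) - ((c₂ * shapeVal t.2.1 : ℕ) : ℤ) := by
      rw [← heq, Nat.cast_add, add_sub_cancel_right]
      exact Int.natCast_dvd_natCast.mpr hd1
    refine mem_filter.mpr ⟨mem_product.mpr ⟨freezeOn_mem_subBox Qᶜ hbx, mem_product.mpr ⟨hby, hbz⟩⟩, ?_⟩
    simp only [hψ, onVal_freezeOn_compl]
    exact ⟨h12, h13, hdvd⟩
  -- (c) assemble
  calc (shapeCount c₁ c₂ c₃ X Y Z : ℝ) = (F.card : ℝ) := rfl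
    _ ≤ (Dτ : ℝ) ^ d * ((F.image ψ).card : ℝ) := by exact_mod_cast hfib
    _ ≤ _ := mul_le_mul_of_nonneg_left (Nat.cast_le.mpr himg) (by positivity)

end Summit.ABC.ABC.Theorems.MazurKaneLaw
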